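import Literature.MathematicalPhysics.KineticTheory.Georgii1995HardSphereCanonicalLocalLimit

/-!
# The canonical local limit, I: decomposition of Georgii's named fact (line `FirstLemma`, crux stmt-AtomisticToContinuum-14135)

Helper file of the registered stub `stub_georgiiCanonicalLocalLimit : Georgii1995_hardSphereCanonicalLocalLimit`
(Literature NAMED FACT, `Literature/MathematicalPhysics/KineticTheory/Georgii1995HardSphereCanonicalLocalLimit.lean`;
Georgii 1995, Thms 3.3–3.4 and Remark 3.6: equivalence of ensembles on the level of measures for the periodic canonical
hard-sphere gas), namespace `Summit.AtomisticToContinuum.HydrodynamicLimit.Theorems.KiferCompactification`.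

The fact is split into its two mathematically distinct halves, typed here as posited statements (NOT claimed):

* `canonicalBlowUpLaw σ a θ u₀ N Φ` — the x-AVERAGED BLOWN-UP CANONICAL LAW: the law on `PointConfig (ℝ³ × ℝ³)` of
  OVY's blow-up `blowUp ε_N x z` (`ε_N = hsDiameter σ N`) under `dx ⊗ localGibbsLaw σ a u₀ θ N Φ` (uniform base point,
  canonical law of `N + 1` spheres with constant profiles); `IsCanonicalLocalLimit σ a θ u₀ N Φ G` — `G` is the SETWISE
  LOCAL LIMIT of these laws along the sizes `N k`: on every bounded measurable window the window laws converge on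
  every measurable event;
* (E1) `CanonicalBlowUpLocallyCompact` — COMPACTNESS: along a subsequence of any `N k → ∞` the laws converge locally
  to some translation-invariant probability law `G`, almost surely a unit-hard-core configuration, of density
  exactly `σ³` (provable in principle from uniform bounds on the window densities of the canonical law, the
  x-averaging and the deterministic packing bound; posited here);
* (E2) `CanonicalLocalLimitIsGibbs` — IDENTIFICATION: every such local limit is a DLR Gibbs state
  `IsHardSphereGibbs 1 z θ⁻¹ u₀ G` of the unit-diameter gas for some activity `z > 0` (the genuinely cited content,
  Georgii 1995 Thm 3.4; posited here);
* `georgii1995_hardSphereCanonicalLocalLimit_of : CanonicalBlowUpLocallyCompact → CanonicalLocalLimitIsGibbs →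
  Georgii1995_hardSphereCanonicalLocalLimit` (PROVED: E2 is applied to the subsequence and the limit produced by E1).

References: H.-O. Georgii, *The equivalence of ensembles for classical systems of particles*, J. Stat. Phys. 80
(1995), Thms 3.3, 3.4, Remark 3.6; S. Olla, S. R. S. Varadhan, H.-T. Yau, Comm. Math. Phys. 155 (1993) §4 (blow-up).
-/

noncomputable section

open MeasureTheory Set Filter Topology
open scoped ENNReal NNReal

namespace Summit.AtomisticToContinuum.HydrodynamicLimit.Theorems.KiferCompactification

open Literature.MathematicalPhysics.KineticTheory (T3 V3 hsDiameter localGibbsLaw blowUp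
  Georgii1995_hardSphereCanonicalLocalLimit)
open Literature.MathematicalPhysics.KineticTheory.PointProcess (windowLaw density)
open Literature.Analysis.FluidPDE (HardSphereFlow IsHardCore IsHardSphereGibbs IsTranslationInvariant)
open Literature.Analysis.FunctionSpaces (PointConfig)

/-! ## The x-averaged blown-up canonical laws and their local limits -/

/-- The x-AVERAGED BLOWN-UP CANONICAL LAW of `N + 1` hard spheres at reduced diameter `σ` (constant activity `a`,
temperature `θ`, drift `u₀`): the law on configurations of `ℝ³ × ℝ³` of `blowUp ε_N x z`, `ε_N = hsDiameter σ N`,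
under `dx ⊗ localGibbsLaw σ a u₀ θ N Φ` — the finite-`N` object of the named fact
`Georgii1995_hardSphereCanonicalLocalLimit` (Georgii's spatially averaged periodic canonical ensemble, seen at the
scale of the diameter). -/
def canonicalBlowUpLaw (σ a θ : ℝ) (u₀ : V3) (N : ℕ)
    (Φ : HardSphereFlow (Literature.Analysis.FluidPDE.Torus.geometry (Fin 3)) (hsDiameter σ N) (N + 1)) :
    Measure (PointConfig (V3 × V3)) :=
  ((volume : Measure T3).prod (localGibbsLaw σ (fun _ => a) (fun _ => u₀) (fun _ => θ) N Φ)).map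
    fun p => blowUp (hsDiameter σ N) p.1 p.2

/-- `G` is the SETWISE LOCAL LIMIT of the x-averaged blown-up canonical laws along the sizes `N k` (flows `Φ k`):
for every bounded measurable window `Λ ⊆ ℝ³` and every measurable event `A` of configurations, the window-law
probabilities `windowLaw Λ (canonicalBlowUpLaw σ a θ u₀ (N k) (Φ k)) A` converge to `windowLaw Λ G A` (Georgii's
topology of local convergence restricted to bounded local events). -/
def IsCanonicalLocalLimit (σ a θ : ℝ) (u₀ : V3) (N : ℕ → ℕ)
    (Φ : ∀ k, HardSphereFlow (Literature.Analysis.FluidPDE.Torus.geometry (Fin 3)) (hsDiameter σ (N k)) (N k + 1))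
    (G : Measure (PointConfig (V3 × V3))) : Prop :=
  ∀ Λ : Set V3, MeasurableSet Λ → Bornology.IsBounded Λ → ∀ A : Set (PointConfig (V3 × V3)), MeasurableSet A →
    Tendsto (fun k => windowLaw Λ (canonicalBlowUpLaw σ a θ u₀ (N k) (Φ k)) A) atTop (𝓝 (windowLaw Λ G A))

/-- Unfolding `IsCanonicalLocalLimit` to the literal convergence statement of the named fact. -/
theorem isCanonicalLocalLimit_iff {σ a θ : ℝ} {u₀ : V3} {N : ℕ → ℕ}
    {Φ : ∀ k, HardSphereFlow (Literature.Analysis.FluidPDE.Torus.geometry (Fin 3)) (hsDiameter σ (N k)) (N k + 1)}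
    {G : Measure (PointConfig (V3 × V3))} :
    IsCanonicalLocalLimit σ a θ u₀ N Φ G ↔
      ∀ Λ : Set V3, MeasurableSet Λ → Bornology.IsBounded Λ → ∀ A : Set (PointConfig (V3 × V3)), MeasurableSet A →
        Tendsto (fun k => windowLaw Λ
            (((volume : Measure T3).prod
              (localGibbsLaw σ (fun _ => a) (fun _ => u₀) (fun _ => θ) (N k) (Φ k))).map
              (fun p => blowUp (hsDiameter σ (N k)) p.1 p.2)) A)
          atTop (𝓝 (windowLaw Λ G A)) :=
  Iff.rfl

/-- Local limits pass to subsequences. -/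
theorem IsCanonicalLocalLimit.comp_strictMono {σ a θ : ℝ} {u₀ : V3} {N : ℕ → ℕ}
    {Φ : ∀ k, HardSphereFlow (Literature.Analysis.FluidPDE.Torus.geometry (Fin 3)) (hsDiameter σ (N k)) (N k + 1)}
    {G : Measure (PointConfig (V3 × V3))} (h : IsCanonicalLocalLimit σ a θ u₀ N Φ G) {κ : ℕ → ℕ}
    (hκ : StrictMono κ) : IsCanonicalLocalLimit σ a θ u₀ (fun j => N (κ j)) (fun j => Φ (κ j)) G :=
  fun Λ hΛ hΛb A hA => (h Λ hΛ hΛb A hA).comp hκ.tendsto_atTop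

/-! ## (E1) compactness and (E2) identification: the posited decomposition -/

/-- **(E1) LOCAL COMPACTNESS OF THE BLOWN-UP CANONICAL LAWS** (posited decomposition of the named fact
`Georgii1995_hardSphereCanonicalLocalLimit`, first half; NOT claimed here). For `0 < σ ≤ 1/2`, `a, θ > 0` and sizes
`N k → ∞`: along a subsequence `κ` the x-averaged blown-up canonical laws converge locally (setwise on every bounded
window) to a probability law `G` on configurations of `ℝ³ × ℝ³` which is translation invariant, almost surely a
unit-hard-core configuration, and of density exactly `σ³` (`= (N+1) ε_N³`). Mechanism (not formalised): the window
laws of the canonical hard-sphere law have densities with respect to `∑ₖ (Leb_Λ ⊗ Maxwellian)^{⊗k}/k!` bounded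
uniformly in `N` (insertion bound `Z_{N+1} ≥ Z_N (1 - N p_ε)` at density `σ³ ≤ 1/8`), whence setwise sequential
compactness window by window, a diagonal argument over the centred cubes and consistency; translation invariance of
every local limit comes from the averaging over the base point (a blown-up translate is the blow-up at a shifted base
point, exactly on bounded windows for `N` large), the hard core and the density pass to the limit by the deterministic
packing bound on window counts. -/
def CanonicalBlowUpLocallyCompact : Prop :=
  ∀ (σ a θ : ℝ) (u₀ : V3), 0 < σ → σ ≤ 1 / 2 → 0 < a → 0 < θ →
  ∀ (N : ℕ → ℕ)
    (Φ : ∀ k, HardSphereFlow (Literature.Analysis.FluidPDE.Torus.geometry (Fin 3)) (hsDiameter σ (N k)) (N k + 1)),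
    Tendsto N atTop atTop →
    ∃ κ : ℕ → ℕ, StrictMono κ ∧ ∃ G : Measure (PointConfig (V3 × V3)),
      IsProbabilityMeasure G ∧ IsTranslationInvariant G ∧ (∀ᵐ ω ∂G, IsHardCore 1 ω) ∧
      density G = ENNReal.ofReal (σ ^ 3) ∧
      IsCanonicalLocalLimit σ a θ u₀ (fun j => N (κ j)) (fun j => Φ (κ j)) G

/-- **(E2) LOCAL LIMITS OF THE CANONICAL HARD-SPHERE GAS ARE GIBBS** (posited decomposition of the named fact
`Georgii1995_hardSphereCanonicalLocalLimit`, second half — its genuinely cited content, Georgii 1995 Thm 3.4 with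
Thm 3.3 and Remark 3.6; NOT claimed here). For `0 < σ ≤ 1/2`, `a, θ > 0` and sizes `N k → ∞`: every translation-invariant
probability law `G` on configurations of `ℝ³ × ℝ³`, almost surely unit-hard-core and of density `σ³`, which is the
setwise local limit of the x-averaged blown-up canonical laws along `N`, is a DLR Gibbs state of the unit-diameter
hard-sphere gas with Maxwellian marks `(θ⁻¹, u₀)` for SOME activity `z > 0` (accumulation points of averaged periodic
canonical ensembles at density `ρ` are the translation-invariant tempered Gibbs measures `𝒢_Θ(z, β)` of the tangent
parameters; for the hard core the positional canonical ensemble is a pure positional ensemble, momenta attached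
independently). -/
def CanonicalLocalLimitIsGibbs : Prop :=
  ∀ (σ a θ : ℝ) (u₀ : V3), 0 < σ → σ ≤ 1 / 2 → 0 < a → 0 < θ →
  ∀ (N : ℕ → ℕ)
    (Φ : ∀ k, HardSphereFlow (Literature.Analysis.FluidPDE.Torus.geometry (Fin 3)) (hsDiameter σ (N k)) (N k + 1)),
    Tendsto N atTop atTop →
    ∀ G : Measure (PointConfig (V3 × V3)), IsProbabilityMeasure G → IsTranslationInvariant G →
      (∀ᵐ ω ∂G, IsHardCore 1 ω) → density G = ENNReal.ofReal (σ ^ 3) →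
      IsCanonicalLocalLimit σ a θ u₀ N Φ G →
      ∃ z : ℝ, 0 < z ∧ IsHardSphereGibbs 1 z θ⁻¹ u₀ G

/-! ## The reduction -/

/-- **Georgii's named fact from (E1) and (E2).** Given sizes `N k → ∞`, (E1) supplies a subsequence `κ` and a
translation-invariant, almost surely hard-core local limit `G` of density `σ³`; (E2), applied to the subsequence
`N ∘ κ` (still tending to infinity) and to `G`, supplies the activity `z > 0` with `IsHardSphereGibbs 1 z θ⁻¹ u₀ G`;
the convergence clause of the fact is the local-limit property of `G` verbatim. -/
theorem georgii1995_hardSphereCanonicalLocalLimit_of :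
    CanonicalBlowUpLocallyCompact → CanonicalLocalLimitIsGibbs → Georgii1995_hardSphereCanonicalLocalLimit := by
  intro h₁ h₂ σ a θ u₀ hσ hσ2 ha hθ N Φ hN
  obtain ⟨κ, hκ, G, hGP, hGT, hGhc, hGd, hloc⟩ := h₁ σ a θ u₀ hσ hσ2 ha hθ N Φ hN
  obtain ⟨z, hz, hG⟩ := h₂ σ a θ u₀ hσ hσ2 ha hθ (fun j => N (κ j)) (fun j => Φ (κ j))
    (hN.comp hκ.tendsto_atTop) G hGP hGT hGhc hGd hloc
  exact ⟨κ, hκ, z, G, hz, hG, hGT, hGd, fun Λ hΛ hΛb A hA => hloc Λ hΛ hΛb A hA⟩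

end Summit.AtomisticToContinuum.HydrodynamicLimit.Theorems.KiferCompactification

end
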